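import Mathlib

/-!
# Arithmetic core of Theorem L′ (solo-blind SmoothPoincare4, session 11)

For a planar open book `OB(Σ_{0,n}, t_{c_m} ⋯ t_{c_1})` one has `H₁ = coker (A Aᵀ)` where `A` is the 0/1 type
matrix of the curves (paper/contact-splitting.md, Lemma 7).  On `Σ_{0,4}` the only rationally-acyclic
configuration of three vanishing cycles without a boundary-parallel curve is the lantern type, whose Gram
matrix is `I + J = !![2,1,1;1,2,1;1,1,2]`.  We certify: its determinant is `4` and `2·e₁` is not in its image,
so the cokernel (order 4) has an element of order 4, i.e. is `ℤ/4` and not `ℤ/2 ⊕ ℤ/2`; by Hantzsche's theorem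
such a 3-manifold does not embed in a homology 4-sphere, which excludes this cell.  We also certify that
Oba's configuration `(δ₁, {12}, {13})` has unimodular Gram matrix (its open book is a homology sphere).
-/

namespace Summit.SmoothPoincare4.SoloBlind.LanternHomology

open Matrix

/-- Gram matrix `A Aᵀ` of the lantern type configuration `{e₁+e₂, e₂+e₃, e₁+e₃}` on `Σ_{0,4}`. -/
def lanternGram : Matrix (Fin 3) (Fin 3) ℤ := !![2, 1, 1; 1, 2, 1; 1, 1, 2]

/-- Type matrix of the lantern configuration (columns `e₁+e₂`, `e₂+e₃`, `e₁+e₃`). -/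
def lanternType : Matrix (Fin 3) (Fin 3) ℤ := !![1, 0, 1; 1, 1, 0; 0, 1, 1]

/-- The lantern type matrix times its transpose is the Gram matrix `I + J`. -/
theorem lanternType_mul_transpose : lanternType * lanternTypeᵀ = lanternGram := by
  decide

/-- The lantern type matrix has determinant `2` (so `|H₁| = 4`). -/
theorem lanternType_det : lanternType.det = 2 := by
  simp [lanternType, Matrix.det_fin_three]

/-- `det (I + J) = 4` for the `3 × 3` lantern Gram matrix. -/
theorem lanternGram_det : lanternGram.det = 4 := by
  simp [lanternGram, Matrix.det_fin_three]

/-- `2 e₁` is not in the image of the lantern Gram matrix: the cokernel `ℤ³ / (I+J)ℤ³`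
(which has order `det = 4`) therefore contains an element of order `4`, so it is cyclic `ℤ/4`. -/
theorem two_e1_not_mem_range_lanternGram :
    ¬ ∃ x : Fin 3 → ℤ, lanternGram.mulVec x = ![2, 0, 0] := by
  rintro ⟨x, hx⟩
  have h0 := congrFun hx 0
  have h1 := congrFun hx 1
  have h2 := congrFun hx 2
  simp [lanternGram, Matrix.mulVec, dotProduct, Fin.sum_univ_three] at h0 h1 h2
  omega

/-- but `4 e₁` is in the image (so `e₁` has order exactly `4` in the cokernel). -/
theorem four_e1_mem_range_lanternGram :
    ∃ x : Fin 3 → ℤ, lanternGram.mulVec x = ![4, 0, 0] := by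
  refine ⟨![3, -1, -1], ?_⟩
  ext i
  fin_cases i <;> simp [lanternGram, Matrix.mulVec, dotProduct, Fin.sum_univ_three]

/-- Gram matrix of Oba's configuration `(δ₁, {1,2}, {1,3})`: type columns `e₁, e₁+e₂, e₁+e₃`. -/
def obaType : Matrix (Fin 3) (Fin 3) ℤ := !![1, 1, 1; 0, 1, 0; 0, 0, 1]

/-- Oba's type matrix is unimodular. -/
theorem obaType_det : obaType.det = 1 := by
  simp [obaType, Matrix.det_fin_three]

/-- Hence Oba's Gram matrix is unimodular: the open book is an integral homology sphere. -/
theorem obaGram_det : (obaType * obaTypeᵀ).det = 1 := by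
  rw [Matrix.det_mul, Matrix.det_transpose, obaType_det]; norm_num

end Summit.SmoothPoincare4.SoloBlind.LanternHomology
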